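import Literature.MathematicalPhysics.QuantumFieldTheory.Balaban1983to89.B2Eq29Resummation
import Literature.MathematicalPhysics.QuantumFieldTheory.Balaban1983to89.B2Eq22LargeFieldSets

/-!
# Bałaban, *(Higgs)₂,₃ quantum fields in a finite volume II*, CMP **86** (1982), (2.7)/(2.9)/(2.15) pp. 558–559:
# r14's ABSTRACT (2.9)-dictionary `B2Eq29Resummation` INSTANTIATED on the concrete (Higgs)₂,₃ carrier

p. 558, verbatim: *"Let us define: Λ₀ᶜ is the sum of all large blocks of T₁ distant from one of the sets B(P_v), Q_v, R_v,
B(P_s), Q_s, R_s less than r(ε) … (2.7) … for each fixed Λ₀ we have a sum over all admissible sets P_v, …, R_s, i.e.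
defining the set Λ₀ᶜ by (2.7). … In the class of ordered 6-tuples {P_v, Q_v, R_v, P_s, Q_s, R_s} the inclusion relation
between the proper sets defines a natural partial order relation. Thus, there are minimal elements in the class."*;
p. 559 (2.15): *"ζ_{Λ₀} = Σ_{{P_v,…,R_s} admissible, minimal} χᶜ_{P_v}χᶜ_{Q_v}χᶜ_{R_v}χᶜ_{P_s}χᶜ_{Q_s} exp(−p(ε)²|R_s|)"*.

WHAT THIS FILE ADDS.  `B2Eq29Resummation` (r14 gen 3, p246084) types (2.9)/(2.15) over ABSTRACT letters: an index type `S`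
(the disjoint union of the six index sets), a type `β` of large blocks, `N : S → Finset β` (the large blocks within `r(ε)`
of an element), `W : Finset β` (Λ₀ᶜ), `Admissible N W τ :↔ nbhd N τ = W`, Mathlib's `Minimal`, and weights `c : S → ℝ`.
The typer's `B2Eq28RegionsConcrete` (p262717) / `B2Eq22LargeFieldSets` construct print's objects on `HiggsLattice`: the
large-field sets `setPv, …, setRs` of a configuration, the bad sites `badSites`, the region `regionOf … r 0` = Λ₀ of (2.7).
Here the two are IDENTIFIED by kernel theorems:
* `Elem P j` — print's six index sets as ONE inductive type (sorts `pv`, `qv`, `rv`, `ps`, `qs`, `rs` over `T′ = Site P (j+1)`,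
  `T* = PBond P j`, `T = Site P j`); `foot e` — the sites of the element (the block `B(y)`, the two ends of the bond, the
  point); `tuple Pv Qv Rv Ps Qs Rs : Finset (Elem P j)` — the ordered 6-tuple as ONE finite set, so that print's
  *"inclusion relation between the proper sets"* is `⊆` (`tuple_subset_iff`); conversely every `τ : Finset (Elem P j)` is the
  tuple of its six components (`tuple_components`), so r14's `Minimal (Admissible N W)` IS print's minimality (`minimal_tuple_iff`);
* `biUnion_foot_tuple`: the typer's `badSites Pv Ps Qv Qs Rv Rs` IS `(tuple …).biUnion foot`;
* `nearN r e` — r14's `N`: the large blocks (`HiggsRescaling.LargeBlock P j`) within `r` of `foot e` in the typer's block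
  distance `lbDist`; **`not_mem_region_iff`** / **`not_mem_regionOf_iff`**: `x ∈ (Λ₀(τ))ᶜ` of (2.7) (typer) ⟺
  `largeBlockOf x ∈ nbhd (nearN r) τ` (r14) — the abstract Λ₀ᶜ of a tuple IS the concrete one;
* `blocksOutside Λ₀` — r14's `W`: the large blocks outside Λ₀; **`admissible_iff_region_eq`**: for `Λ₀` a union of large
  blocks, r14's `Admissible (nearN r) (blocksOutside Λ₀) τ` ⟺ the (2.7)-region of the tuple `τ` is `Λ₀` — print's
  *"admissible sets P_v, …, R_s, i.e. defining the set Λ₀ᶜ by (2.7)"*; `admissible_tuple_self`: a configuration's own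
  large-field tuple is admissible for its own `Λ₀` (`B2Eq22LargeFieldSets.lambda0`);
* the weights of (2.15) for a configuration: `weight215` (the indicators `χᶜ` of the six (2.2) events, by sort), `IsRs`,
  and `zeta215At` := r14's `zeta215` at the instance, with its unfolding `zeta215At_eq`.
HONEST SCOPE.  Level-generic `j` (print: `T₁`, level 0); the radius `r` is a free real (print: `r(ε) = R(1 + log ε⁻¹)^r` in
lattice units); distances are the typer's `lbDist` (from the LARGE BLOCK of a site to a site, (2.7) read blockwise, as in
`B2Eq28RegionsConcrete`); bookkeeping only — no field estimate, no measure.  Serves row B2.Eq2.15 of `ROWS-B2.md` (owner r02's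
audit `READING-RULE-AUDIT-B2-g50.md` §3.1 names this member).  Unit `lit-balaban-r14` gen 22
(literature-prover-lit-balaban-r14-g22-0); HOME/FILED.md records the proposal.  Statement-level skeleton of published theorems
with citation tags; proofs where landed; nothing here is a claim about the Yang–Mills mass gap.
-/

open scoped BigOperators Classical

namespace Literature.MathematicalPhysics.QuantumFieldTheory.Balaban1983to89.B2Eq29DictionaryConcrete

open HiggsLattice HiggsRescaling
open B2Eq28RegionsConcrete (lbDist lbDist_congr region mem_region not_mem_region mem_regionCompl_zero badSites regionOf
  regionOf_eq region_isUnionOfLargeBlocks isUnionOfLargeBlocks_iff)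
open B2Eq22LargeFieldSets (devB devPsi ind setPv setQv setRv setPs setQs setRs bad24 lambda0)
open B2Eq255Concrete (dA absA absPhi)
open B2Eq29Resummation (nbhd mem_nbhd Admissible zeta215 zetaW minimals)

noncomputable section

variable {P : HiggsLattice.Params} {j : ℕ} {N : ℕ}

/-! ## §1 The six index sets as one type; footprints; 6-tuples as finite sets -/

/-- **Print's six index sets `T′₁ ⊔ T*₁ ⊔ T₁ ⊔ T′₁ ⊔ T*₁ ⊔ T₁`** (the carriers of `P_v, Q_v, R_v, P_s, Q_s, R_s`, (2.6)) as
ONE index type — r14's abstract `S`. [cite: Balaban1982Higgs2, (2.6) p.558] -/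
inductive Elem (P : HiggsLattice.Params) (j : ℕ) : Type
  /-- a block-lattice point `y ∈ T′` carrying the event `|B(y) − (QA)(y)| > p(ε)` (sort `P_v`). -/
  | pv : HiggsLattice.Site P (j + 1) → Elem P j
  /-- a bond `b ∈ T*` carrying `|(∂A)(b)| > p(ε)` (sort `Q_v`). -/
  | qv : HiggsLattice.PBond P j → Elem P j
  /-- a point `x ∈ T` carrying `|A(x)| > p(ε)/(μ₀ε)` (sort `R_v`). -/
  | rv : HiggsLattice.Site P j → Elem P j
  /-- a block-lattice point `y ∈ T′` carrying `|ψ(y) − (Q(A)φ)(y)| > p(ε)` (sort `P_s`). -/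
  | ps : HiggsLattice.Site P (j + 1) → Elem P j
  /-- a bond `b ∈ T*` carrying `|(D_Aφ)(b)| > p(ε)` (sort `Q_s`). -/
  | qs : HiggsLattice.PBond P j → Elem P j
  /-- a point `x ∈ T` carrying `|φ(x)| > p(ε)/λ(ε)^{1/4}` (sort `R_s`). -/
  | rs : HiggsLattice.Site P j → Elem P j
  deriving Fintype

/-- **The sites of an element** — p. 558 measures distances *"from one of the sets B(P_v), Q_v, R_v, B(P_s), Q_s, R_s"*:
the block `B(y)` for the `P`-sorts, the two ends of the bond for the `Q`-sorts, the point for the `R`-sorts (= the typer's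
`badSites`, elementwise). [cite: Balaban1982Higgs2, (2.7) p.558] -/
def foot : Elem P j → Finset (HiggsLattice.Site P j)
  | .pv y => HiggsLattice.block y
  | .qv b => {b.src, b.tgt}
  | .rv x => {x}
  | .ps y => HiggsLattice.block y
  | .qs b => {b.src, b.tgt}
  | .rs x => {x}

/-- **The ordered 6-tuple `{P_v, Q_v, R_v, P_s, Q_s, R_s}` as ONE finite set of elements** (r14's `τ : Finset S`).
[cite: Balaban1982Higgs2, (2.9) p.558] -/
def tuple (Pv : Finset (HiggsLattice.Site P (j + 1))) (Qv : Finset (HiggsLattice.PBond P j)) (Rv : Finset (HiggsLattice.Site P j))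
    (Ps : Finset (HiggsLattice.Site P (j + 1))) (Qs : Finset (HiggsLattice.PBond P j)) (Rs : Finset (HiggsLattice.Site P j)) :
    Finset (Elem P j) :=
  Pv.image Elem.pv ∪ Qv.image Elem.qv ∪ Rv.image Elem.rv ∪ Ps.image Elem.ps ∪ Qs.image Elem.qs ∪ Rs.image Elem.rs

section Tuple

variable (Pv Ps : Finset (HiggsLattice.Site P (j + 1))) (Qv Qs : Finset (HiggsLattice.PBond P j)) (Rv Rs : Finset (HiggsLattice.Site P j))

/-- The `P_v`-component of a tuple. [cite: Balaban1982Higgs2, (2.9) p.558] -/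
@[simp] theorem pv_mem_tuple {y : HiggsLattice.Site P (j + 1)} : Elem.pv y ∈ tuple Pv Qv Rv Ps Qs Rs ↔ y ∈ Pv := by
  simp [tuple]

/-- The `Q_v`-component of a tuple. [cite: Balaban1982Higgs2, (2.9) p.558] -/
@[simp] theorem qv_mem_tuple {b : HiggsLattice.PBond P j} : Elem.qv b ∈ tuple Pv Qv Rv Ps Qs Rs ↔ b ∈ Qv := by
  simp [tuple]

/-- The `R_v`-component of a tuple. [cite: Balaban1982Higgs2, (2.9) p.558] -/
@[simp] theorem rv_mem_tuple {x : HiggsLattice.Site P j} : Elem.rv x ∈ tuple Pv Qv Rv Ps Qs Rs ↔ x ∈ Rv := by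
  simp [tuple]

/-- The `P_s`-component of a tuple. [cite: Balaban1982Higgs2, (2.9) p.558] -/
@[simp] theorem ps_mem_tuple {y : HiggsLattice.Site P (j + 1)} : Elem.ps y ∈ tuple Pv Qv Rv Ps Qs Rs ↔ y ∈ Ps := by
  simp [tuple]

/-- The `Q_s`-component of a tuple. [cite: Balaban1982Higgs2, (2.9) p.558] -/
@[simp] theorem qs_mem_tuple {b : HiggsLattice.PBond P j} : Elem.qs b ∈ tuple Pv Qv Rv Ps Qs Rs ↔ b ∈ Qs := by
  simp [tuple]

/-- The `R_s`-component of a tuple. [cite: Balaban1982Higgs2, (2.9) p.558] -/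
@[simp] theorem rs_mem_tuple {x : HiggsLattice.Site P j} : Elem.rs x ∈ tuple Pv Qv Rv Ps Qs Rs ↔ x ∈ Rs := by
  simp [tuple]

/-- Membership in a tuple, by cases on the sort. [cite: Balaban1982Higgs2, (2.9) p.558] -/
theorem mem_tuple_iff (e : Elem P j) :
    e ∈ tuple Pv Qv Rv Ps Qs Rs ↔
      (match e with
        | .pv y => y ∈ Pv | .qv b => b ∈ Qv | .rv x => x ∈ Rv
        | .ps y => y ∈ Ps | .qs b => b ∈ Qs | .rs x => x ∈ Rs) := by
  cases e <;> simp

variable {Pv Ps Qv Qs Rv Rs}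

/-- **Print's partial order IS `⊆`**: *"the inclusion relation between the proper sets defines a natural partial order
relation"* — componentwise inclusion of 6-tuples is inclusion of the finite sets. [cite: Balaban1982Higgs2, (2.9) p.558] -/
theorem tuple_subset_iff {Pv' Ps' : Finset (HiggsLattice.Site P (j + 1))} {Qv' Qs' : Finset (HiggsLattice.PBond P j)}
    {Rv' Rs' : Finset (HiggsLattice.Site P j)} :
    tuple Pv Qv Rv Ps Qs Rs ⊆ tuple Pv' Qv' Rv' Ps' Qs' Rs' ↔
      Pv ⊆ Pv' ∧ Qv ⊆ Qv' ∧ Rv ⊆ Rv' ∧ Ps ⊆ Ps' ∧ Qs ⊆ Qs' ∧ Rs ⊆ Rs' := by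
  constructor
  · intro h
    refine ⟨fun y hy => ?_, fun b hb => ?_, fun x hx => ?_, fun y hy => ?_, fun b hb => ?_, fun x hx => ?_⟩
    · exact (pv_mem_tuple Pv' Ps' Qv' Qs' Rv' Rs').mp (h ((pv_mem_tuple Pv Ps Qv Qs Rv Rs).mpr hy))
    · exact (qv_mem_tuple Pv' Ps' Qv' Qs' Rv' Rs').mp (h ((qv_mem_tuple Pv Ps Qv Qs Rv Rs).mpr hb))
    · exact (rv_mem_tuple Pv' Ps' Qv' Qs' Rv' Rs').mp (h ((rv_mem_tuple Pv Ps Qv Qs Rv Rs).mpr hx))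
    · exact (ps_mem_tuple Pv' Ps' Qv' Qs' Rv' Rs').mp (h ((ps_mem_tuple Pv Ps Qv Qs Rv Rs).mpr hy))
    · exact (qs_mem_tuple Pv' Ps' Qv' Qs' Rv' Rs').mp (h ((qs_mem_tuple Pv Ps Qv Qs Rv Rs).mpr hb))
    · exact (rs_mem_tuple Pv' Ps' Qv' Qs' Rv' Rs').mp (h ((rs_mem_tuple Pv Ps Qv Qs Rv Rs).mpr hx))
  · rintro ⟨h1, h2, h3, h4, h5, h6⟩ e he
    cases e with
    | pv y => exact (pv_mem_tuple _ _ _ _ _ _).mpr (h1 ((pv_mem_tuple _ _ _ _ _ _).mp he))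
    | qv b => exact (qv_mem_tuple _ _ _ _ _ _).mpr (h2 ((qv_mem_tuple _ _ _ _ _ _).mp he))
    | rv x => exact (rv_mem_tuple _ _ _ _ _ _).mpr (h3 ((rv_mem_tuple _ _ _ _ _ _).mp he))
    | ps y => exact (ps_mem_tuple _ _ _ _ _ _).mpr (h4 ((ps_mem_tuple _ _ _ _ _ _).mp he))
    | qs b => exact (qs_mem_tuple _ _ _ _ _ _).mpr (h5 ((qs_mem_tuple _ _ _ _ _ _).mp he))
    | rs x => exact (rs_mem_tuple _ _ _ _ _ _).mpr (h6 ((rs_mem_tuple _ _ _ _ _ _).mp he))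

/-- The `P_v`-component of a finite set of elements. [cite: Balaban1982Higgs2, (2.9) p.558] -/
def pvOf (τ : Finset (Elem P j)) : Finset (HiggsLattice.Site P (j + 1)) := Finset.univ.filter fun y => Elem.pv y ∈ τ
/-- The `Q_v`-component. [cite: Balaban1982Higgs2, (2.9) p.558] -/
def qvOf (τ : Finset (Elem P j)) : Finset (HiggsLattice.PBond P j) := Finset.univ.filter fun b => Elem.qv b ∈ τ
/-- The `R_v`-component. [cite: Balaban1982Higgs2, (2.9) p.558] -/
def rvOf (τ : Finset (Elem P j)) : Finset (HiggsLattice.Site P j) := Finset.univ.filter fun x => Elem.rv x ∈ τ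
/-- The `P_s`-component. [cite: Balaban1982Higgs2, (2.9) p.558] -/
def psOf (τ : Finset (Elem P j)) : Finset (HiggsLattice.Site P (j + 1)) := Finset.univ.filter fun y => Elem.ps y ∈ τ
/-- The `Q_s`-component. [cite: Balaban1982Higgs2, (2.9) p.558] -/
def qsOf (τ : Finset (Elem P j)) : Finset (HiggsLattice.PBond P j) := Finset.univ.filter fun b => Elem.qs b ∈ τ
/-- The `R_s`-component. [cite: Balaban1982Higgs2, (2.9) p.558] -/
def rsOf (τ : Finset (Elem P j)) : Finset (HiggsLattice.Site P j) := Finset.univ.filter fun x => Elem.rs x ∈ τ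

/-- **Every finite set of elements IS an ordered 6-tuple** (of its six components): r14's `τ : Finset S` and print's
`{P_v, Q_v, R_v, P_s, Q_s, R_s}` are the same data, so Mathlib's `Minimal (Admissible N W)` for `⊆` on `Finset (Elem P j)`
(r14's "minimal") IS print's minimality for the componentwise inclusion order (`tuple_subset_iff`). PROVED.
[cite: Balaban1982Higgs2, (2.9) p.558] -/
theorem tuple_components (τ : Finset (Elem P j)) :
    tuple (pvOf τ) (qvOf τ) (rvOf τ) (psOf τ) (qsOf τ) (rsOf τ) = τ := by
  ext e
  cases e <;> simp [pvOf, qvOf, rvOf, psOf, qsOf, rsOf]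

/-- **Print's "minimal" = r14's `Minimal`**, spelled out on 6-tuples: a tuple is a minimal admissible one iff it is
admissible and every admissible tuple componentwise below it is (componentwise) equal to it. PROVED.
[cite: Balaban1982Higgs2, (2.9) p.558] -/
theorem minimal_tuple_iff (Nn : Elem P j → Finset (LargeBlock P j)) (W : Finset (LargeBlock P j)) :
    Minimal (Admissible Nn W) (tuple Pv Qv Rv Ps Qs Rs) ↔
      Admissible Nn W (tuple Pv Qv Rv Ps Qs Rs) ∧
        ∀ (Pv' Ps' : Finset (HiggsLattice.Site P (j + 1))) (Qv' Qs' : Finset (HiggsLattice.PBond P j))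
          (Rv' Rs' : Finset (HiggsLattice.Site P j)),
          Admissible Nn W (tuple Pv' Qv' Rv' Ps' Qs' Rs') →
            Pv' ⊆ Pv ∧ Qv' ⊆ Qv ∧ Rv' ⊆ Rv ∧ Ps' ⊆ Ps ∧ Qs' ⊆ Qs ∧ Rs' ⊆ Rs →
              Pv ⊆ Pv' ∧ Qv ⊆ Qv' ∧ Rv ⊆ Rv' ∧ Ps ⊆ Ps' ∧ Qs ⊆ Qs' ∧ Rs ⊆ Rs' := by
  rw [Minimal]
  refine and_congr_right fun _ => ⟨fun h Pv' Ps' Qv' Qs' Rv' Rs' hadm hle => ?_, fun h τ' hadm hle => ?_⟩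
  · exact tuple_subset_iff.mp (h hadm (tuple_subset_iff.mpr hle))
  · rw [← tuple_components τ'] at hadm hle ⊢
    exact tuple_subset_iff.mpr (h _ _ _ _ _ _ hadm (tuple_subset_iff.mp hle))

/-- **The bad sites of the typer's (2.7) construction ARE the footprints of the tuple**:
`badSites Pv Ps Qv Qs Rv Rs = ⋃_{e ∈ tuple} foot e`. PROVED. [cite: Balaban1982Higgs2, (2.7) p.558] -/
theorem biUnion_foot_tuple :
    (tuple Pv Qv Rv Ps Qs Rs).biUnion foot = badSites Pv Ps Qv Qs Rv Rs := by
  ext z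
  simp only [Finset.mem_biUnion, badSites, Finset.mem_union, mem_blockSet, Finset.mem_image]
  constructor
  · rintro ⟨e, he, hz⟩
    cases e with
    | pv y =>
      rw [pv_mem_tuple] at he
      simp only [foot, HiggsLattice.block, Finset.mem_filter, Finset.mem_univ, true_and] at hz
      exact Or.inl (Or.inl (Or.inl (Or.inl (Or.inl (hz ▸ he)))))
    | qv b =>
      rw [qv_mem_tuple] at he
      simp only [foot, Finset.mem_insert, Finset.mem_singleton] at hz
      rcases hz with rfl | rfl
      · exact Or.inl (Or.inl (Or.inl (Or.inr (Or.inl ⟨b, he, rfl⟩))))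
      · exact Or.inl (Or.inl (Or.inl (Or.inr (Or.inr ⟨b, he, rfl⟩))))
    | rv x =>
      rw [rv_mem_tuple] at he
      simp only [foot, Finset.mem_singleton] at hz
      exact Or.inl (Or.inr (hz ▸ he))
    | ps y =>
      rw [ps_mem_tuple] at he
      simp only [foot, HiggsLattice.block, Finset.mem_filter, Finset.mem_univ, true_and] at hz
      exact Or.inl (Or.inl (Or.inl (Or.inl (Or.inr (hz ▸ he)))))
    | qs b =>
      rw [qs_mem_tuple] at he
      simp only [foot, Finset.mem_insert, Finset.mem_singleton] at hz
      rcases hz with rfl | rfl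
      · exact Or.inl (Or.inl (Or.inr (Or.inl ⟨b, he, rfl⟩)))
      · exact Or.inl (Or.inl (Or.inr (Or.inr ⟨b, he, rfl⟩)))
    | rs x =>
      rw [rs_mem_tuple] at he
      simp only [foot, Finset.mem_singleton] at hz
      exact Or.inr (hz ▸ he)
  · rintro (((((h | h) | (⟨b, hb, rfl⟩ | ⟨b, hb, rfl⟩)) | (⟨b, hb, rfl⟩ | ⟨b, hb, rfl⟩)) | h) | h)
    · exact ⟨.pv (HiggsLattice.blockOf z), (pv_mem_tuple _ _ _ _ _ _).mpr h, by simp [foot, HiggsLattice.block]⟩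
    · exact ⟨.ps (HiggsLattice.blockOf z), (ps_mem_tuple _ _ _ _ _ _).mpr h, by simp [foot, HiggsLattice.block]⟩
    · exact ⟨.qv b, (qv_mem_tuple _ _ _ _ _ _).mpr hb, by simp [foot]⟩
    · exact ⟨.qv b, (qv_mem_tuple _ _ _ _ _ _).mpr hb, by simp [foot]⟩
    · exact ⟨.qs b, (qs_mem_tuple _ _ _ _ _ _).mpr hb, by simp [foot]⟩
    · exact ⟨.qs b, (qs_mem_tuple _ _ _ _ _ _).mpr hb, by simp [foot]⟩
    · exact ⟨.rv z, (rv_mem_tuple _ _ _ _ _ _).mpr h, by simp [foot]⟩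
    · exact ⟨.rs z, (rs_mem_tuple _ _ _ _ _ _).mpr h, by simp [foot]⟩

end Tuple

/-! ## §2 r14's `N` on the carrier and the identification of Λ₀ᶜ(τ) with the typer's (2.7) region -/

/-- **r14's `N x`** on the carrier: the LARGE blocks of `T^{(j)}` lying within `r` of the element `e` — *"large blocks …
distant from one of the sets B(P_v), …, R_s less than r(ε)"* — in the typer's block distance `lbDist` (from the large block
of a site to a site). [cite: Balaban1982Higgs2, (2.7) p.558] -/
def nearN (r : ℝ) (e : Elem P j) : Finset (LargeBlock P j) :=
  Finset.univ.filter fun Z => ∃ x : HiggsLattice.Site P j, largeBlockOf x = Z ∧ ∃ z ∈ foot e, lbDist x z < r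

variable {r : ℝ}

/-- Membership in `nearN r e`. [cite: Balaban1982Higgs2, (2.7) p.558] -/
theorem mem_nearN {e : Elem P j} {Z : LargeBlock P j} :
    Z ∈ nearN r e ↔ ∃ x : HiggsLattice.Site P j, largeBlockOf x = Z ∧ ∃ z ∈ foot e, lbDist x z < r := by
  simp [nearN]

/-- The large block OF A SITE `x` is near `e` iff `x`'s block distance to some site of `e` is `< r` (the distance depends
only on the large block: `lbDist_congr`). [cite: Balaban1982Higgs2, (2.7) p.558] -/
theorem largeBlockOf_mem_nearN {e : Elem P j} {x : HiggsLattice.Site P j} :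
    largeBlockOf x ∈ nearN r e ↔ ∃ z ∈ foot e, lbDist x z < r := by
  rw [mem_nearN]
  constructor
  · rintro ⟨x', hx', z, hz, hlt⟩
    exact ⟨z, hz, by rwa [← lbDist_congr hx'.symm z] at hlt⟩
  · intro h
    exact ⟨x, rfl, h⟩

/-- **Λ₀ᶜ(τ): r14's abstract = the typer's concrete.**  For every tuple `τ` and radius `r`: a site `x` lies OUTSIDE the
typer's (2.7)-region built on the footprints of `τ` iff its large block lies in r14's `nbhd (nearN r) τ = ⋃_{e∈τ} N e`.
PROVED. [cite: Balaban1982Higgs2, (2.7) p.558, (2.9) p.558] -/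
theorem not_mem_region_iff (τ : Finset (Elem P j)) (x : HiggsLattice.Site P j) :
    x ∉ region (↑(τ.biUnion foot) : Set (HiggsLattice.Site P j)) r 0 ↔ largeBlockOf x ∈ nbhd (nearN r) τ := by
  rw [not_mem_region, mem_regionCompl_zero, mem_nbhd]
  constructor
  · rintro ⟨z, hz, hlt⟩
    rw [Finset.mem_coe, Finset.mem_biUnion] at hz
    obtain ⟨e, he, hze⟩ := hz
    exact ⟨e, he, largeBlockOf_mem_nearN.mpr ⟨z, hze, hlt⟩⟩
  · rintro ⟨e, he, hZ⟩
    obtain ⟨z, hz, hlt⟩ := largeBlockOf_mem_nearN.mp hZ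
    exact ⟨z, by rw [Finset.mem_coe, Finset.mem_biUnion]; exact ⟨e, he, hz⟩, hlt⟩

/-- The same for a tuple given by its six components, against the typer's `regionOf Pv Ps Qv Qs Rv Rs r 0` (= Λ₀ of (2.7)).
PROVED. [cite: Balaban1982Higgs2, (2.7) p.558, (2.9) p.558] -/
theorem not_mem_regionOf_iff (Pv Ps : Finset (HiggsLattice.Site P (j + 1))) (Qv Qs : Finset (HiggsLattice.PBond P j))
    (Rv Rs : Finset (HiggsLattice.Site P j)) (x : HiggsLattice.Site P j) :
    x ∉ regionOf Pv Ps Qv Qs Rv Rs r 0 ↔ largeBlockOf x ∈ nbhd (nearN r) (tuple Pv Qv Rv Ps Qs Rs) := by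
  rw [regionOf_eq, ← biUnion_foot_tuple, not_mem_region_iff]

/-! ## §3 r14's `W` and `Admissible` on the carrier -/

/-- **r14's `W`** for a fixed region `Λ₀`: the large blocks lying OUTSIDE `Λ₀` (Λ₀ᶜ *"is the sum of … large blocks"*).
[cite: Balaban1982Higgs2, (2.7) p.558] -/
def blocksOutside (Λ₀ : Finset (HiggsLattice.Site P j)) : Finset (LargeBlock P j) :=
  Finset.univ.filter fun Z => ∃ x : HiggsLattice.Site P j, largeBlockOf x = Z ∧ x ∉ Λ₀

/-- Membership in `blocksOutside Λ₀`. [cite: Balaban1982Higgs2, (2.7) p.558] -/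
theorem mem_blocksOutside {Λ₀ : Finset (HiggsLattice.Site P j)} {Z : LargeBlock P j} :
    Z ∈ blocksOutside Λ₀ ↔ ∃ x : HiggsLattice.Site P j, largeBlockOf x = Z ∧ x ∉ Λ₀ := by
  simp [blocksOutside]

/-- For a union of large blocks `Λ₀`: the large block of `x` is outside iff `x ∉ Λ₀`. [cite: Balaban1982Higgs2, (2.7) p.558] -/
theorem largeBlockOf_mem_blocksOutside {Λ₀ : Finset (HiggsLattice.Site P j)} (hΛ : IsUnionOfLargeBlocks Λ₀)
    {x : HiggsLattice.Site P j} : largeBlockOf x ∈ blocksOutside Λ₀ ↔ x ∉ Λ₀ := by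
  rw [mem_blocksOutside]
  constructor
  · rintro ⟨x', hx', hx'Λ⟩
    exact fun hx => hx'Λ (((isUnionOfLargeBlocks_iff Λ₀).mp hΛ x x' hx'.symm).mp hx)
  · intro hx
    exact ⟨x, rfl, hx⟩

/-- Every large block in `nbhd (nearN r) τ` is the large block of some site. [cite: Balaban1982Higgs2, (2.7) p.558] -/
theorem exists_site_of_mem_nbhd {τ : Finset (Elem P j)} {Z : LargeBlock P j} (hZ : Z ∈ nbhd (nearN r) τ) :
    ∃ x : HiggsLattice.Site P j, largeBlockOf x = Z := by
  obtain ⟨e, _, he⟩ := mem_nbhd.mp hZ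
  obtain ⟨x, hx, _⟩ := mem_nearN.mp he
  exact ⟨x, hx⟩

/-- **"Admissible": r14's abstract = print's concrete.**  For a union of large blocks `Λ₀`, a tuple `τ` is
`Admissible (nearN r) (blocksOutside Λ₀) τ` (r14: its Λ₀ᶜ is `W`) iff the typer's (2.7)-region of its footprints IS `Λ₀`
— *"for each fixed Λ₀ … all admissible sets P_v, …, R_s, i.e. defining the set Λ₀ᶜ by (2.7)"*. PROVED.
[cite: Balaban1982Higgs2, (2.7) p.558, (2.9) p.558] -/
theorem admissible_iff_region_eq {Λ₀ : Finset (HiggsLattice.Site P j)} (hΛ : IsUnionOfLargeBlocks Λ₀) (τ : Finset (Elem P j)) :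
    Admissible (nearN r) (blocksOutside Λ₀) τ ↔ region (↑(τ.biUnion foot) : Set (HiggsLattice.Site P j)) r 0 = Λ₀ := by
  rw [B2Eq29Resummation.admissible_iff_eq]
  constructor
  · intro h
    ext x
    have hx := not_mem_region_iff (r := r) τ x
    rw [h, largeBlockOf_mem_blocksOutside hΛ] at hx
    exact not_iff_not.mp hx
  · intro h
    ext Z
    constructor
    · intro hZ
      obtain ⟨x, rfl⟩ := exists_site_of_mem_nbhd hZ
      rw [largeBlockOf_mem_blocksOutside hΛ, ← h]
      exact (not_mem_region_iff τ x).mpr hZ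
    · intro hZ
      obtain ⟨x, rfl, hx⟩ := mem_blocksOutside.mp hZ
      rw [← h] at hx
      exact (not_mem_region_iff τ x).mp hx

/-- The same for a tuple given by its six components: admissible for `Λ₀` iff `regionOf Pv Ps Qv Qs Rv Rs r 0 = Λ₀`. PROVED.
[cite: Balaban1982Higgs2, (2.7) p.558, (2.9) p.558] -/
theorem admissible_tuple_iff {Λ₀ : Finset (HiggsLattice.Site P j)} (hΛ : IsUnionOfLargeBlocks Λ₀)
    (Pv Ps : Finset (HiggsLattice.Site P (j + 1))) (Qv Qs : Finset (HiggsLattice.PBond P j)) (Rv Rs : Finset (HiggsLattice.Site P j)) :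
    Admissible (nearN r) (blocksOutside Λ₀) (tuple Pv Qv Rv Ps Qs Rs) ↔ regionOf Pv Ps Qv Qs Rv Rs r 0 = Λ₀ := by
  rw [admissible_iff_region_eq hΛ, regionOf_eq, biUnion_foot_tuple]

/-- Every tuple is admissible for ITS OWN (2.7)-region. [cite: Balaban1982Higgs2, (2.7) p.558, (2.9) p.558] -/
theorem admissible_self (Pv Ps : Finset (HiggsLattice.Site P (j + 1))) (Qv Qs : Finset (HiggsLattice.PBond P j))
    (Rv Rs : Finset (HiggsLattice.Site P j)) :
    Admissible (nearN r) (blocksOutside (regionOf Pv Ps Qv Qs Rv Rs r 0)) (tuple Pv Qv Rv Ps Qs Rs) :=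
  (admissible_tuple_iff (by rw [regionOf_eq]; exact region_isUnionOfLargeBlocks _ r 0) Pv Ps Qv Qs Rv Rs).mpr rfl

/-! ## §4 The configuration's instance: the large-field tuple, the weights of (2.15), `ζ_{Λ₀}` -/

section Config

variable (C : ChargeData N) (p qA qφ : ℝ) (ext : HiggsLattice.VecField P 0) (Abg : HiggsLattice.VecField P j)
  (B : HiggsLattice.VecField P (j + 1)) (A : HiggsLattice.VecField P j) (ψ : ScalarField P (j + 1) N) (φ : ScalarField P j N)

/-- **The large-field 6-tuple OF A CONFIGURATION** — the typer's six sets `setPv, …, setRs` of `B2Eq22LargeFieldSets`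
((2.4)–(2.5): the elements at which one of the inequalities (2.2) holds) as one finite set of elements.
[cite: Balaban1982Higgs2, (2.2) p.557, (2.4)–(2.6) pp.557–558] -/
def configTuple : Finset (Elem P j) :=
  tuple (setPv p B A) (setQv p A) (setRv qA A) (setPs C p ext ψ φ) (setQs C p Abg φ) (setRs qφ φ)

/-- The footprints of the configuration's tuple are the typer's `bad24`. [cite: Balaban1982Higgs2, (2.7) p.558] -/
theorem biUnion_foot_configTuple :
    (configTuple C p qA qφ ext Abg B A ψ φ).biUnion foot = bad24 C p qA qφ ext Abg B A ψ φ := by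
  unfold configTuple bad24
  exact biUnion_foot_tuple

/-- **A configuration's own tuple is admissible for its own `Λ₀`** (`B2Eq22LargeFieldSets.lambda0`): the term of the
configuration in (2.6) is filed under its region in the resummation (2.9)–(2.10). PROVED. [cite: Balaban1982Higgs2, (2.9)–(2.10) p.558] -/
theorem admissible_configTuple :
    Admissible (nearN r) (blocksOutside (lambda0 C p qA qφ ext Abg B A ψ φ r)) (configTuple C p qA qφ ext Abg B A ψ φ) := by
  have hΛ : IsUnionOfLargeBlocks (lambda0 C p qA qφ ext Abg B A ψ φ r) := region_isUnionOfLargeBlocks _ r 0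
  rw [admissible_iff_region_eq hΛ, biUnion_foot_configTuple]
  rfl

/-- **The weights `χᶜ` of (2.9)/(2.15) for a configuration**, by sort: the indicator of the (2.2) event of the element
(`|B(y) − (QA)(y)| > p(ε)`, `|(∂A)(b)| > p(ε)`, `|A(x)| > p(ε)/(μ₀ε)` (threshold `qA`), `|ψ(y) − (Q(A)φ)(y)| > p(ε)`,
`|(D_Aφ)(b)| > p(ε)`, `|φ(x)| > p(ε)/λ(ε)^{1/4}` (threshold `qφ`)) — r14's `c : S → ℝ`. [cite: Balaban1982Higgs2, (2.2) p.557, (2.9) p.558] -/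
def weight215 : Elem P j → ℝ
  | .pv y => ind (p < devB B A y)
  | .qv b => ind (p < dA A b)
  | .rv x => ind (qA < absA A x)
  | .ps y => ind (p < devPsi C ext ψ φ y)
  | .qs b => ind (p < ‖covDeriv C Abg φ b‖)
  | .rs x => ind (qφ < absPhi φ x)

/-- The sort predicate *"x is of sort R_s"* of (2.15) (its indicator is replaced by `exp(−p(ε)²)`, by (2.13)).
[cite: Balaban1982Higgs2, (2.13) p.559, (2.15) p.559] -/
def IsRs : Elem P j → Prop
  | .rs _ => True
  | _ => False

/-- An element lies in the configuration's tuple iff its weight is `1` (the (2.2) event holds), and otherwise the weight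
is `0`. [cite: Balaban1982Higgs2, (2.4)–(2.6) pp.557–558] -/
theorem weight215_eq_ite (e : Elem P j) :
    weight215 C p qA qφ ext Abg B A ψ φ e = if e ∈ configTuple C p qA qφ ext Abg B A ψ φ then 1 else 0 := by
  cases e <;>
    simp [weight215, configTuple, ind, B2Eq22LargeFieldSets.mem_setPv, B2Eq22LargeFieldSets.mem_setQv,
      B2Eq22LargeFieldSets.mem_setRv, B2Eq22LargeFieldSets.mem_setPs, B2Eq22LargeFieldSets.mem_setQs,
      B2Eq22LargeFieldSets.mem_setRs]

/-- **`ζ_{Λ₀}` of (2.15) ON THE CARRIER**: r14's `zeta215` at the instance `N := nearN r`, `W := blocksOutside Λ₀`,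
`isRs := IsRs`, `c := weight215 (configuration)`, `pε := p(ε)`. [cite: Balaban1982Higgs2, (2.15) p.559] -/
def zeta215At (r : ℝ) (Λ₀ : Finset (HiggsLattice.Site P j)) (pε : ℝ) : ℝ :=
  zeta215 (nearN r) (blocksOutside Λ₀) IsRs (weight215 C p qA qφ ext Abg B A ψ φ) pε

/-- Unfolding of `zeta215At` into print's sum over the minimal admissible tuples:
`ζ_{Λ₀} = Σ_{τ admissible, minimal} Π_{e ∈ τ} (e of sort R_s ? exp(−p(ε)²) : χᶜ_e)`. [cite: Balaban1982Higgs2, (2.15) p.559] -/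
theorem zeta215At_eq (r : ℝ) (Λ₀ : Finset (HiggsLattice.Site P j)) (pε : ℝ) :
    zeta215At C p qA qφ ext Abg B A ψ φ r Λ₀ pε
      = ∑ τ ∈ minimals (nearN r) (blocksOutside Λ₀),
          ∏ e ∈ τ, (if IsRs e then Real.exp (-(pε ^ 2)) else weight215 C p qA qφ ext Abg B A ψ φ e) := rfl

/-- `ζ_{Λ₀} ≥ 0` on the carrier (all weights are indicators or `exp(−p(ε)²)`). [cite: Balaban1982Higgs2, (2.15) p.559] -/
theorem zeta215At_nonneg (r : ℝ) (Λ₀ : Finset (HiggsLattice.Site P j)) (pε : ℝ) :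
    0 ≤ zeta215At C p qA qφ ext Abg B A ψ φ r Λ₀ pε := by
  unfold zeta215At zeta215
  refine B2Eq29Resummation.zetaW_nonneg _ _ fun e => ?_
  split_ifs
  · exact (Real.exp_pos _).le
  · rw [weight215_eq_ite]
    split_ifs <;> norm_num

end Config

end

end Literature.MathematicalPhysics.QuantumFieldTheory.Balaban1983to89.B2Eq29DictionaryConcrete
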